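import Summits.QuantumFields.BalabanUV.T4Continuum.Support.ShellMeasureLiveEndOneCallUnionLevels
import Summits.QuantumFields.BalabanUV.T4Continuum.Support.ShellMeasureLiveEndOneCallLevelsToy
import Summits.QuantumFields.BalabanUV.T4Continuum.Support.ShellMeasureLevelZeroShellMass

/-!
# `T4Continuum.ShellMeasureLiveEndOneCallUnionLevelsToy` — row S96 f3: RULE G-1 FOR THE ONE CALL OF RECORD — S95 f3
# `ShellMeasureLiveEndOneCallUnionLevels.shellWeightBound_live_oneCall_union_levels` FIRED BY NAME, EVERY BINDER SUPPLIED, with BOTH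
# slot kinds populated (a GIBBS slot ⊔ a BACKGROUND-MEDIATED slot per comparison index and run) at TWO scales (`η = 1`, `η = ½`)
(cell `pub-balaban`, sub-cell `t4`, spine estimate NE7c (node U5b); NE7c ROUND-2 crew, unit `b2b-balaban-t4-ne7c-formalise-leaf-10`
gen 12; row S96 (owner g34 R-ne7cp1-g34-2 (d) «two slots, two η, nonzero read-out»; R-g34-3 (a): on S95 f3's outside read THE ONE
CALL OF RECORD := `…_union_levels`); ADDITIVE — imports S95 f3 `ShellMeasureLiveEndOneCallUnionLevels` (p232965, leaf-09-g12), S96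
f2 `ShellMeasureLiveEndOneCallLevelsToy` (numerics `gibbs_sm`∕`gibbs_rad`; through it S96 f1, S88, S80 f4, S89 f1) and S89 f2
`ShellMeasureLevelZeroShellMass` (`shellMass_pos`) ONLY; [folklore]; 0 `def`, 0 `def … : Prop`, 0 sorry, 0 citation tags)

HONEST FRAMING.  A TOY: a CONSISTENCY CERTIFICATE of the ≈ 400-name hypothesis list of THE ONE CALL OF RECORD — nothing about
Bałaban's minimiser, propagators, kernels, densities or counts.  Finite four-torus programme, rung (B)+1 only — NOT infinite volume,
NOT a mass gap, NOT the Clay problem, NOT summit progress; NE7c (`T4IndicatorShell.ShellWeightBound` for the cell's expansions) NOT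
PRINTED, NOT PROVED; «NE7c ⇐ the named binders» (c3); `ShellWeightBound` on a toy ≠ NE7c.  HONEST DEPENDENCY (cell): continuum YM on
T⁴ ⇐ BetaPertH ∧ nine spine estimates (0/9 proved); BetaPertH ⇐ (D1) ∧ (D4) ∧ CAP+tail; G-an2-4 gates asym, D1 and NE2/3/4.

THE SCHEME (§2 **`shellWeightBound_live_oneCall_union_levels_toy`**).  `σ₀ := σ₁ := Unit`; per run `r : Bool` and comparison index `K`
TWO live slots at END-I level `K` (`{inl (), inr ()}`, window depth `0`, count `2`), both on S89 f1's torus `toyParams` at lattice level `0`: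
the GIBBS slot = S1's face on the side-2 box at corner `0` (block `blockBonds 0 2`, classifier `wilsonU` over `boxPlaqF 0 2`, `P_w = ∅`,
chart radius `S0 := S`, co-test threshold `σc := 4·toyεθ S`; rows `hSM`∕`hSMσ`∕`hrad` by S96 f2's `gibbs_sm`∕`gibbs_rad`; `hF₀`∕`hu₀` by
`rfl` — the density∕variable families ARE `Sum.elim (Gibbs face) (S88 data)`); the BACKGROUND-MEDIATED slot = S96 f1's S88 model at
`p r K : Plaq toyParams 0` with S80 f4's degenerate (T2)∕(T3)∕(S78) families and the six LIFTED rows as constant profiles (`κr ≡ κc ≡ 3`,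
`κwb ≡ κcb ≡ 1`, `dbar ≡ 0`, `Kw ≡ 1`); SHARED `η true ≡ 1`, `η false ≡ ½`, `ε ≡ 4·toyεθ S`, `ρ_j = ϑ^j∕4`, `β ≡ 0`, `c₁ = 4`, `c₂ = 2`,
`zs = 1`, `δ = ½`, `D ≡ D̄ = 12 + 4·#(Λ × Fin 3)`; END-I rows: `T K = {()}`, weights = the two legs' total masses, pieces = the two
slots' realized shell masses PUSHED WITH EQUALITY (`M ≡ 1`), shell part = their sum.  CONCLUSION LITERALLY `ShellWeightBound l₀
(K ↦ {()}) A B shA shB (K ↦ Σ_{s ∈ {()} ⊔ {()}} D·(ϑ^K∕4) + Σ … )` for every `l₀`, `0 < S ≤ 10⁻⁶`, `0 < ϑ < 1`, `p`, `e`, `hPu`.  §3: the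
GIBBS slots' shells are LIVE in both runs (S89 f2 `shellMass_pos` BY NAME: raw thresholds `4θ₀`∕`θ₀ ≤` the co-test `4θ₀`); the S88
slots' by S96 f1 `shellPart_pos_A`∕`_B`.  NOT DONE: (T2)∕(T3) estimates (zero kernels), two-run closeness, the regime `η_j → 0` (S95's
in-file (x2) visits it; a FIXED nonzero read-out cannot).  NOTHING in the countdown moves.
-/

noncomputable section

open Set Metric NormedSpace MeasureTheory Function

namespace Summit.QuantumFields.BalabanUV.T4Continuum.ShellMeasureLiveEndOneCallUnionLevelsToy

open scoped ENNReal Matrix.Norms.L2Operator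
open Literature.MathematicalPhysics.QuantumFieldTheory.Balaban1983to89
open B11Prop6Scheme (Prop4Hyp)
open GaugeField (GaugeInvariant plaqHol)
open T4ShellMeasure (SlotAntiConcentration)
open T4CubePoincare (cube mem_cube_iff)
open T4CubeChartGnomonic (SU2)
open T4CubeChartExp (expPt expFibreChart)
open T4TreeGaugeFixing (NoClosedLoop fixTo noClosedLoop_empty fixTo_empty)
open T4ExpWindowSmallField (dist1_expPt_eq dist1_eq_norm_coe_sub_one)
open T4ShellMeasurePlaquette (expTail₂)
open T4IndicatorShell (ShellWeightBound)
open T4ShellMeasureLevels (LiveWindow)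
open T4AxialGaugeSmallField (castSite)
open ShellMeasureLevelAssembly (classifier)
open ShellMeasureWilsonWords (wordExp wordExp_cons wordExp_nil)
open ShellMeasureMultiGridNorms (WSup)
open ShellMeasurePinnedNorm (pinW)
open ShellMeasureDecayKernelSums (kerOp kerOp_apply)
open ShellMeasureLandauHolonomy (solAt landauExp)
open ShellMeasureLandauHolonomyChart (holOf cplx holOf_apply)
open ShellMeasureLandauHolonomySkew (readOutReal)
open ShellMeasureWilsonRealizedSU2 (M₂ gen coe_chart gen_mem_skewAdjoint wilsonU)
open ShellMeasureWilsonGaugeInvariant (giF giF_le_one)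
open ShellMeasureLandauEndFinalToy (b₁ toyCentre toyF toyU tau toyReadOut toyJco toyεθ measurable_toyF measurable_toyU
  gaugeInvariant_toyF gaugeInvariant_toyU toyF_le_one toyF_one toyF_supp norm_tau toyReadOut_apply norm_toyReadOut_le
  toyReadOut_cplx solAt_zero landauExp_zero smul_mem_cube toyF_section_mono toyεθ_pos dist1_plaqHol_section toy_threshold_lt_window)
open ShellMeasureLandauEndFinalToyMass (m₀_eq_three toy_shellMass_eq haar_shell_pos toy_totalMass_pos_le_one)
open ShellMeasureLandauEndAssembledToy (norm_kerOp_zero_le)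
open ShellMeasureLevelZeroBoxWitness (blockBonds boxPlaqF mem_boxPlaqF toyParams toyParams_sitesPerDir blockBonds_box
  disjoint_blockBonds_comb cover_blockBonds boxPlaqF_box dir_zero_lt_one side_two_nonwrapping side_two_side side_two_square)
open ShellMeasureLevelZeroShellMass (shellMass_pos)
open ShellMeasureLiveEndOneCallToy (lintegral_toyF_ne_top toy_measure_ne_top)
open ShellMeasureLiveEndOneCallLevelsToy (gibbs_sm gibbs_rad toyεθ_le_sq)
open ShellMeasureLiveEndOneCallUnionLevels (shellWeightBound_live_oneCall_union_levels)

/-! ## §1 Small suppliers: finiteness of the Gibbs face, the two-slot window -/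

/-- the Gibbs face integrates to at most `1` against product Haar (`giF ≤ 1` for `β = 0`): END-I's `hFfin` on the Gibbs slots. [folklore] -/
theorem lintegral_giF_ne_top (S : ℝ) :
    ∫⁻ U, giF (P := toyParams) (j := 0) (0 : Fin toyParams.d → ℤ) (fun _ => (0 : ℤ) + 2) (4 * toyεθ S) 0 ∅ U
      ∂(fieldMeasure toyParams 0 SU2) ≠ ∞ :=
  ne_top_of_le_ne_top ENNReal.one_ne_top
    ((lintegral_mono fun U => giF_le_one _ _ le_rfl ∅ U).trans_eq (by rw [lintegral_one, measure_univ]))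

/-- (W1) for TWO slots per comparison index at the top level: depth `N₁ = 0`, count `ν̄ = 2`. [folklore] -/
theorem twoSlot_liveWindow :
    LiveWindow (fun _ : ℕ => (({()} : Finset Unit).disjSum ({()} : Finset Unit))) (fun K _ => K) 0 2 :=
  ⟨fun _ _ _ => le_rfl, fun _ _ _ => le_rfl, fun K j' => by
    exact_mod_cast (Finset.card_filter_le _ (fun _ => K = j')).trans (by rw [Finset.card_disjSum, Finset.card_singleton])⟩

variable [DecidableEq (PBond toyParams 0)]

/-! ## §2 THE ONE CALL OF RECORD APPLIED BY NAME TO THE TWO-LEG, TWO-SCALE TOY SCHEME -/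

/-- **RULE G-1 FOR THE ONE CALL OF RECORD**: S95 f3 `shellWeightBound_live_oneCall_union_levels` APPLIED BY NAME to the two-leg
two-scale scheme of the module docstring, every binder family supplied, none left as a hypothesis.  A consistency certificate; nothing
about Bałaban's objects; NE7c NOT PROVED. [folklore] -/
theorem shellWeightBound_live_oneCall_union_levels_toy (p : Bool → ℕ → Plaq toyParams 0) {m₀ : Bool → ℕ → ℕ}
    (e : ∀ r K, ↥({b₁ (p r K)} : Finset (PBond toyParams 0)) × Fin 3 ≃ Fin (m₀ r K))
    (hPu : (boxPlaqF (P := toyParams) (j := 0) 0 (fun _ => (0 : ℤ) + 2)).Nonempty)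
    {S : ℝ} (hS : 0 < S) (hS6 : S ≤ 1 / 10 ^ 6) {ϑ : ℝ} (hϑ0 : 0 < ϑ) (hϑ1 : ϑ < 1) (l₀ : ℝ) :
    ShellWeightBound l₀ (fun _ : ℕ => ({()} : Finset Unit))
      (fun K _ _ => (((fieldMeasure toyParams 0 SU2).withDensity
          (giF (0 : Fin toyParams.d → ℤ) (fun _ => (0 : ℤ) + 2) (4 * toyεθ S) 0 ∅)) Set.univ).toReal +
        (((fieldMeasure toyParams 0 SU2).withDensity (toyF S (p true K))) Set.univ).toReal)
      (fun K _ _ => (((fieldMeasure toyParams 0 SU2).withDensity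
          (giF (0 : Fin toyParams.d → ℤ) (fun _ => (0 : ℤ) + 2) (4 * toyεθ S) 0 ∅)) Set.univ).toReal +
        (((fieldMeasure toyParams 0 SU2).withDensity (toyF S (p false K))) Set.univ).toReal)
      (fun K _ _ => (((fieldMeasure toyParams 0 SU2).withDensity
          (giF (0 : Fin toyParams.d → ℤ) (fun _ => (0 : ℤ) + 2) (4 * toyεθ S) 0 ∅))
          {U | 4 * toyεθ S * (1 - ϑ ^ K / 4) ≤ wilsonU hPu U / 1 ^ 2 ∧ wilsonU hPu U / 1 ^ 2 < 4 * toyεθ S}).toReal +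
        (((fieldMeasure toyParams 0 SU2).withDensity (toyF S (p true K)))
          {U | 4 * toyεθ S * (1 - ϑ ^ K / 4) ≤ toyU (p true K) U / 1 ^ 2 ∧ toyU (p true K) U / 1 ^ 2 < 4 * toyεθ S}).toReal)
      (fun K _ _ => (((fieldMeasure toyParams 0 SU2).withDensity
          (giF (0 : Fin toyParams.d → ℤ) (fun _ => (0 : ℤ) + 2) (4 * toyεθ S) 0 ∅))
          {U | 4 * toyεθ S * (1 - ϑ ^ K / 4) ≤ wilsonU hPu U / (1 / 2) ^ 2 ∧ wilsonU hPu U / (1 / 2) ^ 2 < 4 * toyεθ S}).toReal +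
        (((fieldMeasure toyParams 0 SU2).withDensity (toyF S (p false K)))
          {U | 4 * toyεθ S * (1 - ϑ ^ K / 4) ≤ toyU (p false K) U / (1 / 2) ^ 2 ∧
            toyU (p false K) U / (1 / 2) ^ 2 < 4 * toyεθ S}).toReal)
      (fun K => ∑ _s ∈ (({()} : Finset Unit).disjSum ({()} : Finset Unit)),
          (12 + 4 * ((Fintype.card (↥(blockBonds (P := toyParams) (j := 0) 0 (fun _ => (0 : ℤ) + 2)) × Fin 3) : ℕ) : ℝ)) *
            (ϑ ^ K / 4) +
        ∑ _s ∈ (({()} : Finset Unit).disjSum ({()} : Finset Unit)),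
          (12 + 4 * ((Fintype.card (↥(blockBonds (P := toyParams) (j := 0) 0 (fun _ => (0 : ℤ) + 2)) × Fin 3) : ℕ) : ℝ)) *
            (ϑ ^ K / 4)) := by
  have hS6' : S < 1 / 6 := by linarith
  have hS8 : S ≤ 1 / 8 := by linarith
  have hSπ : 3 * S ^ 2 < Real.pi ^ 2 := by nlinarith [Real.pi_gt_three]
  have hθ0 : 0 < toyεθ S := toyεθ_pos hS hS6'
  have hρ1 : ∀ K : ℕ, ϑ ^ K / 4 ≤ (1 - 1 / 2) / 2 := fun K => by
    have := pow_le_one₀ hϑ0.le hϑ1.le (n := K); linarith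
  have h3 : 3 ≤ toyParams.sitesPerDir 0 := by rw [toyParams_sitesPerDir]; norm_num
  have hN := side_two_nonwrapping (j := 0) h3 (0 : Fin toyParams.d → ℤ)
  set CARD : ℕ := Fintype.card (↥(blockBonds (P := toyParams) (j := 0) 0 (fun _ => (0 : ℤ) + 2)) × Fin 3) with hCARDdef
  have hCARD : (0 : ℝ) ≤ (CARD : ℝ) := Nat.cast_nonneg _
  have hsm := gibbs_sm hS hS8
  have hSMt : 4 * (8 * S) ^ 2 * Real.exp (2 * (8 * S)) ≤ 1 / 2 * (4 * toyεθ S * 1 ^ 2) := by nlinarith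
  have hSMf : 4 * (8 * S) ^ 2 * Real.exp (2 * (8 * S)) ≤ 1 / 2 * (4 * toyεθ S * (1 / 2) ^ 2) := by nlinarith
  have hSMσ : 4 * (8 * S) ^ 2 * Real.exp (2 * (8 * S)) ≤ 1 / 2 * (4 * toyεθ S) := by nlinarith
  have hD₀' : 2 * ((CARD : ℝ) + 0 * ∑ _p ∈ (∅ : Finset (Plaq toyParams 0)), (8 * S) * (8 + 4 * (8 * S))) / (1 - 1 / 2) ≤
      12 + 4 * (CARD : ℝ) := by
    rw [Finset.sum_empty, mul_zero, add_zero]; linarith [show 2 * (CARD : ℝ) / (1 - 1 / 2) = 4 * CARD by ring]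
  set Fam : Bool → ℕ → Unit ⊕ Unit → (GaugeField toyParams 0 SU2 → ℝ≥0∞) := fun r K s =>
    Sum.elim (fun _ => giF (0 : Fin toyParams.d → ℤ) (fun _ => (0 : ℤ) + 2) (4 * toyεθ S) 0 ∅) (fun _ => toyF S (p r K)) s with hFam
  set ufam : Bool → ℕ → Unit ⊕ Unit → (GaugeField toyParams 0 SU2 → ℝ) := fun r K s =>
    Sum.elim (fun _ => wilsonU hPu) (fun _ => toyU (p r K)) s with hufam
  set μg : Measure (GaugeField toyParams 0 SU2) := (fieldMeasure toyParams 0 SU2).withDensity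
    (giF (0 : Fin toyParams.d → ℤ) (fun _ => (0 : ℤ) + 2) (4 * toyεθ S) 0 ∅) with hμg
  set μ : Bool → ℕ → Measure (GaugeField toyParams 0 SU2) := fun r K => (fieldMeasure toyParams 0 SU2).withDensity (toyF S (p r K))
  set Shg : Bool → ℕ → Set (GaugeField toyParams 0 SU2) := fun r K =>
    {U | 4 * toyεθ S * (1 - ϑ ^ K / 4) ≤ wilsonU hPu U / cond r 1 (1 / 2) ^ 2 ∧ wilsonU hPu U / cond r 1 (1 / 2) ^ 2 < 4 * toyεθ S}
  set Sh : Bool → ℕ → Set (GaugeField toyParams 0 SU2) := fun r K =>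
    {U | 4 * toyεθ S * (1 - ϑ ^ K / 4) ≤ toyU (p r K) U / cond r 1 (1 / 2) ^ 2 ∧ toyU (p r K) U / cond r 1 (1 / 2) ^ 2 < 4 * toyεθ S}
  set piece : Bool → ℕ → Unit ⊕ Unit → ℝ := fun r K s => Sum.elim (fun _ => (μg (Shg r K)).toReal) (fun _ => (μ r K (Sh r K)).toReal) s
  have hμg_fin : ∀ B, μg B ≠ ∞ := fun B => ne_top_of_le_ne_top (ne_top_of_le_ne_top ENNReal.one_ne_top (by
    rw [hμg, withDensity_apply _ MeasurableSet.univ, Measure.restrict_univ]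
    exact (lintegral_mono fun U => giF_le_one _ _ le_rfl ∅ U).trans_eq (by rw [lintegral_one, measure_univ])))
    (measure_mono (subset_univ B))
  -- END-I's rows, per run
  have sh_nonneg : ∀ (r : Bool) (K : ℕ) (t : ℝ), |t| ≤ l₀ → ∀ τ ∈ ({()} : Finset Unit),
      0 ≤ (μg (Shg r K)).toReal + (μ r K (Sh r K)).toReal := fun _ _ _ _ _ _ => by positivity
  have sh_le : ∀ (r : Bool) (K : ℕ) (t : ℝ), |t| ≤ l₀ → ∀ τ ∈ ({()} : Finset Unit),
      (μg (Shg r K)).toReal + (μ r K (Sh r K)).toReal ≤ (μg Set.univ).toReal + (μ r K Set.univ).toReal :=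
    fun r K _ _ _ _ => add_le_add (ENNReal.toReal_mono (hμg_fin _) (measure_mono (subset_univ _)))
      (ENNReal.toReal_mono (toy_measure_ne_top hS hS6' (p r K) _) (measure_mono (subset_univ _)))
  have cover : ∀ (r : Bool) (K : ℕ) (t : ℝ), |t| ≤ l₀ → ∀ τ ∈ ({()} : Finset Unit),
      (μg (Shg r K)).toReal + (μ r K (Sh r K)).toReal ≤ ∑ s ∈ (({()} : Finset Unit).disjSum ({()} : Finset Unit)), piece r K s :=
    fun _ _ _ _ _ _ => by rw [Finset.sum_disjSum, Finset.sum_singleton, Finset.sum_singleton]; exact le_rfl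
  have hM : ∀ (r : Bool) (K : ℕ) (t : ℝ), |t| ≤ l₀ → ∀ s ∈ (({()} : Finset Unit).disjSum ({()} : Finset Unit)), (0 : ℝ) ≤ 1 :=
    fun _ _ _ _ _ _ => zero_le_one
  have piece_le : ∀ (r : Bool) (K : ℕ) (t : ℝ), |t| ≤ l₀ → ∀ s ∈ (({()} : Finset Unit).disjSum ({()} : Finset Unit)),
      ∑ _τ ∈ ({()} : Finset Unit), piece r K s ≤ 1 * (((fieldMeasure toyParams 0 SU2).withDensity (Fam r K s))
        {U | 4 * toyεθ S * (1 - ϑ ^ K / 4) ≤ ufam r K s U / cond r 1 (1 / 2) ^ 2 ∧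
          ufam r K s U / cond r 1 (1 / 2) ^ 2 < 4 * toyεθ S}).toReal := by
    intro r K t _ s hs
    rcases Finset.mem_disjSum.1 hs with ⟨a, -, rfl⟩ | ⟨b, -, rfl⟩ <;> (rw [Finset.sum_singleton, one_mul]; exact le_rfl)
  have total_ge : ∀ (r : Bool) (K : ℕ) (t : ℝ), |t| ≤ l₀ → ∀ s ∈ (({()} : Finset Unit).disjSum ({()} : Finset Unit)),
      1 * (((fieldMeasure toyParams 0 SU2).withDensity (Fam r K s)) Set.univ).toReal ≤
        ∑ _τ ∈ ({()} : Finset Unit), ((μg Set.univ).toReal + (μ r K Set.univ).toReal) := by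
    intro r K t _ s hs
    rcases Finset.mem_disjSum.1 hs with ⟨a, -, rfl⟩ | ⟨b, -, rfl⟩ <;> rw [Finset.sum_singleton, one_mul]
    · exact le_add_of_nonneg_right ENNReal.toReal_nonneg
    · exact le_add_of_nonneg_left ENNReal.toReal_nonneg
  refine shellWeightBound_live_oneCall_union_levels (σ₀ := Unit) (σ₁ := Unit) (n := Fin 2) (fun _ _ _ => toyParams) (fun _ _ _ => 0)
    (fun _ K _ => K)
    (ε := fun _ _ => 4 * toyεθ S) (η := fun r _ => cond r 1 (1 / 2)) (ρ := fun _ j' => ϑ ^ j' / 4) (β := fun _ _ => 0)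
    (D := fun _ _ => 12 + 4 * (CARD : ℝ)) (fun r _ => by cases r <;> norm_num) (fun _ _ => mul_pos four_pos hθ0)
    (fun _ _ => by positivity) (fun _ _ => by positivity)
    (fun _ _ => ({()} : Finset Unit)) (fun _ _ => ({()} : Finset Unit)) (l₀ := l₀) (fun r K _ s => Fam r K s) (fun r K _ s => ufam r K s)
    (𝒴 := fun r K _ => Fin (m₀ r K) → ℂ) (𝒴' := fun r K _ => Fin (m₀ r K) → ℂ) (𝒳 := fun r K _ => Fin (m₀ r K) → ℂ)
    (𝒵 := fun r K _ => Fin (m₀ r K) → ℂ) (ℬ := fun r K _ => Fin (m₀ r K) → ℂ) (Tr := fun _ _ _ => ∅)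
    (fun _ _ _ => noClosedLoop_empty) (fun _ _ _ _ => 1) (fun r K _ => {b₁ (p r K)}) (m₀ := fun r K _ => m₀ r K)
    (fun r K _ => e r K) hS hSπ (fun r K _ _ => toyCentre (p r K))
    (fun r K _ _ => measurable_toyF S (p r K)) (fun r K _ _ => gaugeInvariant_toyF S (p r K))
    (fun r K _ _ => toyF_supp S (p r K) 1) (fun r K _ _ => measurable_toyU (p r K))
    (fun r K _ _ => gaugeInvariant_toyU (p r K)) (ιc := fun _ _ _ => Unit) (Pu := fun _ _ _ _ => {()})
    (fun _ _ _ _ => Finset.singleton_nonempty ()) (fun r K _ _ _ => cube (m₀ r K) S)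
    (fun r K _ _ => toyJco S (p r K) (e r K)) (δ := 1 / 2)
    (fun _ _ _ _ _ => 0) (fun _ _ _ _ _ _ => 0) (B₀ := 1) (C₄ := 0) (a₃ := 2 / 3) (ε₄ := 1 / 6)
    (fun _ _ _ _ _ f => by simp) (fun _ _ _ _ _ => ⟨fun Y _ => by simp, differentiableOn_const _⟩) one_pos le_rfl (by norm_num)
    (dL := 1) (C₁ := 1) (B₃ := 1) (ε₁ := 1 / 12) zero_le_one zero_le_one (by norm_num) le_rfl (by norm_num)
    (by norm_num) (by norm_num)
    (fun r K _ _ _ => ContinuousLinearMap.id ℂ (Fin (m₀ r K) → ℂ)) (fun _ _ _ _ _ B => by simp) (fun _ _ _ _ _ => id) (rΦ := 1 / 6)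
    (fun _ _ _ _ _ => differentiableOn_id) (fun _ _ _ _ _ => rfl)
    (fun _ _ _ _ _ z hz => by rw [mem_ball_zero_iff] at hz; simp only [id]; linarith) hS6'
    (fun _ _ _ _ _ _ => 0) (C₂ := 0) (RC := 1) le_rfl (fun _ _ _ _ _ Z _ => by simp) (fun _ _ _ _ _ => differentiableOn_const _)
    (fun _ _ _ _ _ => 0) (fun _ _ _ _ _ Y => by simp) (fun _ _ _ _ _ => 0) (fun _ _ _ _ _ X => by simp) (ε₃ := 1 / 3) (by norm_num)
    (by norm_num) (by norm_num) (fun r K _ _ _ => [toyReadOut (p r K) (e r K)]) (κr := fun _ _ => 3) (fun _ _ _ => by norm_num)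
    (fun r K _ _ _ _ ℓ hℓ Y => by rw [List.mem_singleton.1 hℓ]; exact norm_toyReadOut_le (p r K) (e r K) Y) (m := 1)
    (fun _ _ _ _ _ _ => by simp) (κc := fun _ _ => 3) (fun _ _ _ => by norm_num)
    (fun r K _ _ _ _ Y => by simpa using norm_toyReadOut_le (p r K) (e r K) Y)
    -- ══ (T2): index types `Unit`, fibres `ℂ`, zero pin profile and distance, zero decay kernels ══
    (Λw := fun _ _ _ => Unit) (Λz := fun _ _ _ => Unit) (Λw' := fun _ _ _ => Unit) (Λx := fun _ _ _ => Unit)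
    (Λb := fun _ _ _ => Unit) (𝔖 := fun _ _ _ => Unit)
    (𝔄w := fun _ _ _ => ℂ) (ℭ := fun _ _ _ => ℂ) (𝔄' := fun _ _ _ => ℂ) (𝔅 := fun _ _ _ => ℂ) (𝔇 := fun _ _ _ => ℂ)
    (δw := 0) le_rfl (fun _ _ _ _ _ => 0) (fun _ _ _ _ _ _ => 0) (fun _ _ _ _ _ _ => by simp)
    (fun _ _ _ _ => id) (fun _ _ _ _ => id) (fun _ _ _ _ => id) (fun _ _ _ _ => id) (fun _ _ _ _ => id)
    (fun _ _ _ _ _ _ _ => 0) (fun _ _ _ _ _ _ _ => 0) (fun _ _ _ _ _ _ _ => 0) (fun _ _ _ _ _ _ _ => 0)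
    (c𝒢 := 0) (δ𝒢 := 0) (M𝒢 := 1) (cι := 0) (δι := 0) (Mι := 1) (cH := 0) (δH := 0) (MH := 1)
    (cH₁ := 0) (δH₁ := 0) (MH₁ := 1)
    le_rfl zero_le_one (fun _ _ _ _ _ _ _ => by simp) (fun _ _ _ _ _ => by simp)
    le_rfl zero_le_one (fun _ _ _ _ _ _ _ => by simp) (fun _ _ _ _ _ => by simp)
    le_rfl zero_le_one (fun _ _ _ _ _ _ _ => by simp) (fun _ _ _ _ _ => by simp)
    le_rfl zero_le_one (fun _ _ _ _ _ _ _ => by simp) (fun _ _ _ _ _ => by simp)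
    -- the flat lists of the Wilson tuple
    (fun _ _ _ _ _ _ => 0) (B₀w := 1) (C₄w := 0) (a₃w := 2 / 3) (ε₄w := 1 / 6) (bw := 1 / 6)
    (fun _ _ _ _ _ f => norm_kerOp_zero_le zero_le_one f) (fun _ _ _ _ _ => ⟨fun Y _ => by simp, differentiableOn_const _⟩)
    one_pos le_rfl (by norm_num) (by norm_num) (by norm_num) (by norm_num) (fun _ _ _ _ _ B => norm_kerOp_zero_le zero_le_one B)
    (fun _ _ _ _ _ _ => 0) (rΦw := 1 / 3) (fun _ _ _ _ _ => differentiableOn_const _) (fun _ _ _ _ _ => rfl)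
    (fun _ _ _ _ _ z _ => by simp) (by linarith)
    (fun _ _ _ _ _ _ => 0) (C₂w := 0) (RCw := 2) le_rfl (fun _ _ _ _ _ Z _ => by simp) (fun _ _ _ _ _ => differentiableOn_const _)
    (fun _ _ _ _ _ Y => by simpa using norm_kerOp_zero_le zero_le_one Y) (fun _ _ _ _ _ X => norm_kerOp_zero_le zero_le_one X)
    (by norm_num) (by norm_num)
    -- localities (trivial), reaches `0`, block support, the two contraction numbers
    (fun _ _ _ _ _ _ => True) (fun _ _ _ _ _ A A' c' _ => rfl) (rW := 0) (fun _ _ _ _ _ _ _ => by simp)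
    (fun _ _ _ _ _ _ => True) (fun _ _ _ _ _ A A' c' _ => rfl) (rC := 0) (fun _ _ _ _ _ _ _ => by simp)
    (fun _ _ _ _ _ z i _ => rfl) (by norm_num) (by norm_num)
    -- ONE weight plaquette with ONE zero letter
    (𝔭 := fun _ _ _ => Unit) (fun _ _ _ _ => {()}) (fun _ _ _ _ _ => [0]) (fun _ _ _ _ _ => ∅) (fun _ _ _ _ _ => 0)
    (fun _ _ _ _ _ _ ℓ _ A A' _ => by simp_all) (fun _ _ _ _ _ _ b' hb' => absurd hb' (Finset.notMem_empty _))
    (fun _ _ _ _ _ _ => le_rfl) (κwb := fun _ _ => 1) (κcb := fun _ _ => 1) (fun _ _ _ => zero_le_one) (fun _ _ _ => zero_le_one)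
    (fun _ _ _ _ _ _ ℓ hℓ => by
      rw [List.mem_singleton.1 hℓ]; exact ContinuousLinearMap.opNorm_le_bound _ zero_le_one fun Y => by simp)
    (fun _ _ _ _ _ _ => by
      rw [List.sum_cons, List.sum_nil, add_zero]
      exact ContinuousLinearMap.opNorm_le_bound _ zero_le_one fun Y => by simp)
    (mw := 1) (fun _ _ _ _ _ _ => by simp)
    -- the Wilson tuple's real structure: everything
    (fun _ _ _ _ => ⊤) (fun _ _ _ _ => by simp) (fun _ _ _ _ => ⊤) (fun _ _ _ _ => ⊤) (fun _ _ _ _ => ⊤) (fun _ _ _ _ => by simp)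
    (fun _ _ _ _ => ⊤)
    (fun _ _ _ _ _ f _ => AddSubgroup.mem_top _) (fun _ _ _ _ _ Y _ => AddSubgroup.mem_top _)
    (fun _ _ _ _ _ Y _ => AddSubgroup.mem_top _) (fun _ _ _ _ _ X _ => AddSubgroup.mem_top _)
    (fun _ _ _ _ _ Z _ => AddSubgroup.mem_top _) (fun _ _ _ _ _ B _ => AddSubgroup.mem_top _)
    (fun _ _ _ _ _ y _ => AddSubgroup.mem_top _)
    (fun _ _ _ _ _ _ ℓ hℓ Y _ => by rw [List.mem_singleton.1 hℓ]; simp)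
    -- frozen plaquettes `1`, `d = d̄ = 0`, located count `K_w = 1`
    (fun _ _ _ _ _ _ => 1) (d := fun _ _ _ _ _ => 0) (dbar := fun _ _ => 0) (fun _ _ _ _ _ _ _ => (unitary _).one_mem)
    (fun _ _ _ _ _ _ _ => by simp) (fun _ _ _ _ _ _ => le_rfl) (fun _ _ _ => le_rfl) (Kw := fun _ _ => 1) (fun _ _ _ _ => by simp)
    -- ══ (T3): the located terms' pinned tuple on `Unit → ℂ`, all operators zero, ONE zero term ══
    (Λe := fun _ _ _ => Unit) (𝔄 := fun _ _ _ => ℂ) (δ' := 0) (ϖ := fun _ _ _ _ _ => 0) le_rfl (fun _ _ _ _ _ => le_rfl)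
    (𝒴e' := fun _ _ _ => ℂ) (𝒳e := fun _ _ _ => ℂ) (𝒵e := fun _ _ _ => ℂ) (ℬe := fun _ _ _ => ℂ)
    (fun _ _ _ _ _ => 0) (fun _ _ _ _ _ _ => 0) (B₀e := 1) (C₄e := 0) (a₃e := 2 / 3) (be := 1 / 6) (ε₄e := 1 / 6)
    (fun _ _ _ _ _ f => by simp) (fun _ _ _ _ _ => ⟨fun Y _ => by simp, differentiableOn_const _⟩) one_pos le_rfl (by norm_num)
    (by norm_num) (by norm_num) (by norm_num) (by norm_num)
    (fun _ _ _ _ _ => 0) (fun _ _ _ _ _ B => by simp) (fun _ _ _ _ _ _ => 0) (rΦe := 1 / 3)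
    (fun _ _ _ _ _ => differentiableOn_const _) (fun _ _ _ _ _ => rfl) (fun _ _ _ _ _ z _ => by simp) (by linarith)
    (fun _ _ _ _ _ _ => 0) (C₂e := 0) (RCe := 1) le_rfl (fun _ _ _ _ _ Z _ => by simp) (fun _ _ _ _ _ => differentiableOn_const _)
    (fun _ _ _ _ _ => 0) (fun _ _ _ _ _ Y => by simp) (fun _ _ _ _ _ => 0) (fun _ _ _ _ _ X => by simp) (by norm_num) (by norm_num)
    (𝔱 := fun _ _ _ => Unit) (fun _ _ _ _ => {()}) (Ef := fun _ _ _ _ _ _ => 0) (rE := 1) (ee := fun _ _ _ _ _ => 0) one_pos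
    (fun _ _ _ _ _ _ => differentiableOn_const _) (fun _ _ _ _ _ _ Z _ => by simp) (fun _ _ _ _ _ _ => le_rfl)
    (fun _ _ _ _ _ => ∅) (fun _ _ _ _ _ _ A₁ A₂ _ => rfl) (fun _ _ _ _ _ => 0)
    (fun _ _ _ _ _ _ b' hb' => absurd hb' (Finset.notMem_empty _))
    (LK := 0) le_rfl (fun _ _ _ _ => by simp) (by norm_num) (BE₁ := 0) (fun _ _ _ _ _ y _ => by simp)
    -- ══ (S78): the one-point probability space, `g = 1`, `A = 0`, `B_d = 0` ══
    (Ω := fun _ _ _ => Unit) (fun _ _ _ _ => Measure.dirac ()) (g := fun _ _ _ _ _ => 1) (fun _ _ _ _ _ => zero_le_one)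
    (fun _ _ _ _ _ _ _ => 0) (Bd := 0) le_rfl
    (fun _ _ _ _ _ x _ c' _ _ => by simp) (fun _ _ _ _ _ x _ c' _ _ => by simp) (fun _ _ _ _ _ x _ c' _ _ ω => by simp) (BE₂ := 0)
    (fun _ _ _ _ _ y _ => by simp)
    -- the (T1) real structure and the dictionary (S88 VERBATIM per slot), co-tests, numbers
    (fun r K _ _ => {toyReadOut (p r K) (e r K)}) (fun _ _ _ _ => ⊤) (fun _ _ _ _ => ⊤) (fun _ _ _ _ => ⊤) (fun _ _ _ _ => by simp)
    (fun r K _ _ => readOutReal {toyReadOut (p r K) (e r K)})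
    (fun _ _ _ _ _ f _ => by simp) (fun _ _ _ _ _ Y _ => AddSubgroup.mem_top _)
    (fun _ _ _ _ _ Y _ => AddSubgroup.mem_top _) (fun _ _ _ _ _ X _ => by simp)
    (fun _ _ _ _ _ Z _ => AddSubgroup.mem_top _) (fun _ _ _ _ _ B hB => by simpa using hB)
    (fun r K _ _ _ y _ => ?_) (fun r K _ _ V x hx => ?_) (fun r K _ _ V x _ => ?_)
    (fun r K _ _ V x hJ => ?_) (fun r K _ _ V x a ha => ?_) (fun r K _ _ V x => ?_)
    (fun _ _ _ _ _ => ShellMeasureLandauHolonomyPrint.chartCube_subset_closedBall hS.le)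
    (by norm_num) (by norm_num) (c₁ := 4) (c₂ := 2) (zs := 1)
    (fun r _ _ => by cases r <;> norm_num) (fun r _ _ => by cases r <;> norm_num) (fun _ _ _ => by norm_num) (fun _ _ _ => ?_)
    (fun _ j' => hρ1 j') (fun _ _ => le_rfl)
    -- the slot → level majorant: S80 f3's slot constant on the toy is `12`
    (fun r K _ _ _ _ => by rw [m₀_eq_three (p r K) (e r K)]; norm_num [hCARD])
    -- ══ the GIBBS LEG (`Sum.inl`): S89 f1's side-2 block of `toyParams` at level 0, chart radius `S`, co-test threshold `4·toyεθ S` ══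
    (fun _ _ _ => (0 : Fin toyParams.d → ℤ)) (fun _ _ _ => fun _ => (0 : ℤ) + 2) (mb := fun _ _ _ => 2)
    (fun _ _ _ => hN) (fun _ _ _ => side_two_side (P := toyParams) 0)
    (fun _ _ _ => blockBonds 0 _) (fun _ _ _ => blockBonds_box 0 _) (fun _ _ _ => disjoint_blockBonds_comb 0 _)
    (fun _ _ _ => cover_blockBonds 0 _) (fun _ _ _ => Fintype.equivFin _)
    (S0 := S) hS (by linarith) hSπ (σc := fun _ _ _ => 4 * toyεθ S) (fun _ _ _ => mul_pos four_pos hθ0) (fun _ _ _ => gibbs_rad hS hS6)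
    (fun _ _ _ => hPu) (fun _ _ _ => boxPlaqF_box 0 _) (fun _ _ _ => ∅)
    (fun r _ _ => by cases r; exacts [hSMf, hSMt]) (fun _ _ _ => hSMσ) (fun _ _ _ => hD₀') (fun _ _ _ _ _ => rfl) (fun _ _ _ _ _ => rfl)
    -- ══ END-I's own rows over `({()}).disjSum {()}`: one term per `K`, weights = the two legs' total masses, pieces pushed with equality ══
    (ι := Unit) (T := fun _ => ({()} : Finset Unit))
    (pieceA := fun K _ s _ => piece true K s) (pieceB := fun K _ s _ => piece false K s)
    (MA := fun _ _ _ => 1) (MB := fun _ _ _ => 1) (N₁ := 0) (νbar := 2) (Dbar := 12 + 4 * (CARD : ℝ)) (crate := 1 / 4) (ϑ := ϑ)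
    (fun r K _ s => by cases s; exacts [lintegral_giF_ne_top S, lintegral_toyF_ne_top S (p r K)])
    (sh_nonneg true) (sh_le true) (cover true) (hM true) (piece_le true) (total_ge true)
    (sh_nonneg false) (sh_le false) (cover false) (hM false) (piece_le false) (total_ge false)
    (fun _ => twoSlot_liveWindow) hϑ0 hϑ1 (fun _ _ => le_rfl) (fun _ j' => le_of_eq (by ring))
  · -- `hΦr`: the read-out of a real chart point is skew (S88's dictionary)
    intro ℓ hℓ
    rw [Set.mem_singleton_iff.1 hℓ]
    show toyReadOut (p r K) (e r K) (cplx y) ∈ skewAdjoint M₂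
    rw [toyReadOut_cplx]; exact gen_mem_skewAdjoint _ _ _ _
  · -- `hRdict` (the `Sum.inr` leg's density is S88's): `F(section x) = Jco V x · e^{−(0 + (0 + 0))}` on the cube
    show toyF S (p r K) _ = _
    rw [fixTo_empty, toyJco, indicator_of_mem hx]
    simp
  · -- `hudict` (S88's dictionary VERBATIM)
    have h1 : expFibreChart {b₁ (p r K)} (1 : GaugeField toyParams 0 SU2) (e r K) x ⟨b₁ (p r K), Finset.mem_singleton_self _⟩ =
        expPt (fun i => x (e r K (⟨b₁ (p r K), Finset.mem_singleton_self _⟩, i))) :=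
      show (1 : SU2) * _ = _ from one_mul _
    show toyU (p r K) _ = _
    rw [fixTo_empty, toyU, dist1_plaqHol_section, dist1_eq_norm_coe_sub_one, ← h1, coe_chart]
    simp only [classifier, Finset.sup'_singleton, holOf_apply, List.map_cons, List.map_nil, wordExp_cons, wordExp_nil,
      mul_one, landauExp_zero, solAt_zero _ (by norm_num : (0 : ℝ) ≤ 1 / 6), zero_add, ContinuousLinearMap.coe_id',
      id, toyReadOut_cplx]
  · -- `hJW`
    by_contra h
    exact hJ (indicator_of_notMem h _)
  · -- `hJ`
    unfold toyJco
    by_cases hx : x ∈ cube (m₀ r K) S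
    · rw [indicator_of_mem hx, indicator_of_mem (smul_mem_cube hx ha)]
      exact toyF_section_mono hSπ (p r K) (e r K) V hx ha
    · rw [indicator_of_notMem hx]; exact bot_le
  · -- `hJ1`
    unfold toyJco
    by_cases hx : x ∈ cube (m₀ r K) S
    · rw [indicator_of_mem hx]; exact toyF_le_one S (p r K) _
    · rw [indicator_of_notMem hx]; exact bot_le
  · -- `hsm`: (SM) with equality at the threshold `4·toyεθ S` (`c₁ = 4`, `c₂ = 2`, `zs = 1`, `m = 1`)
    unfold toyεθ
    rw [show (36 : ℝ) * (4 * 1 + ((1 : ℕ) : ℝ) ^ 2 * 2 ^ 2 * 1 ^ 2) = 288 by norm_num,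
      show (1 / 2 : ℝ) * (4 * (144 / ((1 / 6) / S - 1) ^ 2)) = 288 / ((1 / 6) / S - 1) ^ 2 by ring]

/-! ## §3 The GIBBS slots are live in both runs (S89 f2 `shellMass_pos` BY NAME); the S88 slots by S96 f1 `shellPart_pos_A`∕`_B` -/

/-- **RUN A's GIBBS SLOT HAS A LIVE SHELL** (scale `η = 1`: raw threshold `4·toyεθ S` = the co-test threshold; `0 < S ≤ 10⁻⁶`,
`0 < ϑ < 1`). [folklore] -/
theorem gibbs_shellPart_pos_A (hPu : (boxPlaqF (P := toyParams) (j := 0) 0 (fun _ => (0 : ℤ) + 2)).Nonempty) {S : ℝ} (hS : 0 < S)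
    (hS6 : S ≤ 1 / 10 ^ 6) {ϑ : ℝ} (hϑ0 : 0 < ϑ) (hϑ1 : ϑ < 1) (K : ℕ) :
    0 < (((fieldMeasure toyParams 0 SU2).withDensity (giF (0 : Fin toyParams.d → ℤ) (fun _ => (0 : ℤ) + 2) (4 * toyεθ S) 0 ∅))
      {U | 4 * toyεθ S * (1 - ϑ ^ K / 4) ≤ wilsonU hPu U / 1 ^ 2 ∧ wilsonU hPu U / 1 ^ 2 < 4 * toyεθ S}) := by
  have hθ0 : 0 < toyεθ S := toyεθ_pos hS (by linarith)
  have hθ2 : 4 * toyεθ S ≤ 2 := by nlinarith [toyεθ_le_sq hS (by linarith)]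
  have hρ1 : ϑ ^ K / 4 ≤ 1 := by have := pow_le_one₀ hϑ0.le hϑ1.le (n := K); linarith
  have h3 : 3 ≤ toyParams.sitesPerDir 0 := by rw [toyParams_sitesPerDir]; norm_num
  have hd : 2 ≤ toyParams.d := le_rfl
  have h01 := dir_zero_lt_one hd
  have hsq := side_two_square (P := toyParams) (0 : Fin toyParams.d → ℤ) _ _ h01
  have hp₀ : (⟨castSite 0, _, _, h01⟩ : Plaq toyParams 0) ∈ boxPlaqF (P := toyParams) (j := 0) 0 (fun _ => (0 : ℤ) + 2) :=
    mem_boxPlaqF.2 ⟨0, le_rfl, hsq, rfl⟩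
  have hset : {U : GaugeField toyParams 0 SU2 | 4 * toyεθ S * (1 - ϑ ^ K / 4) ≤ wilsonU hPu U / 1 ^ 2 ∧
        wilsonU hPu U / 1 ^ 2 < 4 * toyεθ S} = {U | 4 * toyεθ S * (1 - ϑ ^ K / 4) ≤ wilsonU hPu U ∧ wilsonU hPu U < 4 * toyεθ S} := by
    ext U; simp only [one_pow, div_one, mem_setOf_eq]
  rw [hset]
  exact shellMass_pos (side_two_nonwrapping (j := 0) h3 0) h01 hsq hPu hp₀ (mul_pos four_pos hθ0) le_rfl hθ2 (by positivity) hρ1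
    le_rfl ∅

/-- **RUN B's GIBBS SLOT HAS A LIVE SHELL** (scale `η = ½`: the threshold `4·toyεθ S` in units is `toyεθ S` raw, below the co-test
threshold `4·toyεθ S`). [folklore] -/
theorem gibbs_shellPart_pos_B (hPu : (boxPlaqF (P := toyParams) (j := 0) 0 (fun _ => (0 : ℤ) + 2)).Nonempty) {S : ℝ} (hS : 0 < S)
    (hS6 : S ≤ 1 / 10 ^ 6) {ϑ : ℝ} (hϑ0 : 0 < ϑ) (hϑ1 : ϑ < 1) (K : ℕ) :
    0 < (((fieldMeasure toyParams 0 SU2).withDensity (giF (0 : Fin toyParams.d → ℤ) (fun _ => (0 : ℤ) + 2) (4 * toyεθ S) 0 ∅))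
      {U | 4 * toyεθ S * (1 - ϑ ^ K / 4) ≤ wilsonU hPu U / (1 / 2) ^ 2 ∧ wilsonU hPu U / (1 / 2) ^ 2 < 4 * toyεθ S}) := by
  have hθ0 : 0 < toyεθ S := toyεθ_pos hS (by linarith)
  have hθ2 : toyεθ S ≤ 2 := by nlinarith [toyεθ_le_sq hS (by linarith)]
  have hρ1 : ϑ ^ K / 4 ≤ 1 := by have := pow_le_one₀ hϑ0.le hϑ1.le (n := K); linarith
  have h3 : 3 ≤ toyParams.sitesPerDir 0 := by rw [toyParams_sitesPerDir]; norm_num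
  have hd : 2 ≤ toyParams.d := le_rfl
  have h01 := dir_zero_lt_one hd
  have hsq := side_two_square (P := toyParams) (0 : Fin toyParams.d → ℤ) _ _ h01
  have hp₀ : (⟨castSite 0, _, _, h01⟩ : Plaq toyParams 0) ∈ boxPlaqF (P := toyParams) (j := 0) 0 (fun _ => (0 : ℤ) + 2) :=
    mem_boxPlaqF.2 ⟨0, le_rfl, hsq, rfl⟩
  have hset : {U : GaugeField toyParams 0 SU2 | 4 * toyεθ S * (1 - ϑ ^ K / 4) ≤ wilsonU hPu U / (1 / 2) ^ 2 ∧
        wilsonU hPu U / (1 / 2) ^ 2 < 4 * toyεθ S} = {U | toyεθ S * (1 - ϑ ^ K / 4) ≤ wilsonU hPu U ∧ wilsonU hPu U < toyεθ S} := by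
    ext U
    simp only [mem_setOf_eq, show ∀ x : ℝ, x / (1 / 2) ^ 2 = 4 * x from fun x => by ring]
    constructor <;> rintro ⟨h1, h2⟩ <;> constructor <;> linarith
  rw [hset]
  exact shellMass_pos (side_two_nonwrapping (j := 0) h3 0) h01 hsq hPu hp₀ hθ0 (by linarith) hθ2 (by positivity) hρ1 le_rfl ∅

end Summit.QuantumFields.BalabanUV.T4Continuum.ShellMeasureLiveEndOneCallUnionLevelsToy

end
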